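import Summits.BirchSwinnertonDyer.BirchSwinnertonDyer.Theorems.ResidualThetaTransportAtTwoThetaLayerLambdaCongruenceAtTwoCosocleKanPlus
import HarnessLib

/-!
# Crux K1 `MazurTateCongruenceAtTwoTop` (stmt-BirchSwinnertonDyer-25797 = `MazurTateCongruenceAtTwoR` 21416 BY NAME), line `symbol`:
# THE K1 FLOOR ON THE COSOCLE ROAD — K1 from cosocle multiplicity one at the mod-`2` eigen-ideals + the period fact at `2`;
# Hecke self-duality of `J₀(N)[2]` NOT used
# (width seat bsd-wall-rtt-p3-w3 g10; `--supports stmt-BirchSwinnertonDyer-25797`; THEOREMS ONLY — no `def`, no `sorry`; BSD is not proved)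

STATE OF RECORD BEFORE THIS FILE. K1 ⟸ PUB² {SD, Bz} + the period fact (`mazurTateCongruenceAtTwoTop_of_sdBz_periodTwo`, `…TopOfManinConstant`,
tp2-p1-w2 g5) / PUB³ {SD, Bz, AU}. The ONLY use of SD (`heckeSelfDual_torsionBy_J0`, item 27800) on that road is inside the plus line
`plusLineCharTwo_of_sdBz`: the sub→quotient conversion of mod-`2` multiplicity one at the eigen-ideal. The RTT files
`…ThetaLayerLambdaCongruenceAtTwoCosocleRoad` / `…CosocleKanPlus` (this seat, p648059 / p649433) thread the plus line from the QUOTIENT (cosocle)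
form directly — `plusLineCharTwo_of_mcCosocleW (hMC) (hcosW)`, conclusion VERBATIM — where `hcosW` is the curve-level, Galois-free, pairing-free
statement «`dim_{𝕋/𝔪} Λ/𝔪Λ = 2` at every maximal `𝔪 ∋ 2` of `HeckeRing0 L 2` with `|𝕋/𝔪| = 2` and `T_q − a_q(W) ∈ 𝔪` (`q ∤ L`), for `W`
good supersingular at `2`, `L` odd, all `p ∤ 2L` good», supplied (`cosocleAtEigenIdeal_of_cosocleFact`) by ONE fact of Buzzard's printed shape
whose conclusion is read on the Picard carrier `J₀(N)[2] = H¹(X₀(N); ℤ/2) = Hom(Λ, ℤ/2)` (Buzzard 2000 p. 100: «`T` … generated (via Picard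
functoriality)»; see the module docstring of `…CosocleKanPlus` and `Cruxes/ThetaLayerLambdaCongruenceAtTwo/Lines/birth-pub1-picard.md`).
THIS FILE = §1 of `…TopOfManinConstant` with `(hSD) (hBz)` ↦ `(hcosW)` (statements otherwise VERBATIM, proofs copied with the plus line swapped):
`mazurTateCongruenceAtTwoTop_of_cosocleW_periodTwo_depletedUnitNegDisc / _depletionPrimitiveNegDisc / _ihara`,
**`mazurTateCongruenceAtTwoTop_of_cosocleW_periodTwo : hcosW → realPeriodRat_eq_unit_mul_plusPeriod_two → K1`**, the `MazurTateCongruenceAtTwoR` twin,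
`muInvarianceAtTwo_of_cosocleW_periodTwo`, and **`mazurTateCongruenceAtTwoTop_of_cosocleFact_periodTwo`** (Buzzard-shaped fact, Picard reading,
spelled inline). The PUB³-style `…Au` variants are not re-threaded (Abbes–Ullmo only converts the period fact; compose with
`SkinnerUrban2014.realPeriodRat_eq_unit_mul_plusPeriod_two_fact_of_abbesUllmo` if wanted).

HONEST FRAMING: every theorem is CONDITIONAL on its displayed hypotheses; nothing closes an item; BSD is not proved by any of this.

References: Greenberg–Vatsal, Invent. Math. 142 (2000) Thm. (1.4), §3 (13) [GreenbergVatsal2000]; Vatsal, Duke 98 (1999) Thm. (1.10) [Vatsal1999];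
Buzzard, MRL 7 (2000) Prop. 2.4 [Buzzard2000LevelLoweringModTwo]; Ribet ICM 1983 Thm. 4.1/4.3 [Ribet1984ICM]; BCDT, JAMS 14 (2001) p. 845
[BCDTJAMS2001]; Knapp (1993) Thm. 11.74 [Knapp1993]; Pollack, Duke 118 (2003) [Pollack2003].
-/

-- justification: the `Summit.BirchSwinnertonDyer.BirchSwinnertonDyer.…` path repeats a component (route-file convention)
set_option linter.dupNamespace false
set_option autoImplicit false

noncomputable section

open scoped Classical MatrixGroups ModularForm

open CongruenceSubgroup Polynomial WeierstrassCurve NumberField IsDedekindDomain Rat.HeightOneSpectrum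
  Literature.NumberTheory.IwasawaTheory Literature.NumberTheory.EllipticCurves Literature.NumberTheory.EllipticCurves.ModularForms
  Literature.NumberTheory.EllipticCurves.Rank1Residual Literature.NumberTheory.EllipticCurves.GreenbergVatsal2000
  Literature.NumberTheory.EllipticCurves.Sprung2017 Literature.NumberTheory.GaloisRepresentations
  Summit.BirchSwinnertonDyer.Rank1Residual.Supersingular
  Summit.BirchSwinnertonDyer.BirchSwinnertonDyer.Theorems.ThetaLayerLambdaCongruenceAtTwo

namespace Summit.BirchSwinnertonDyer.BirchSwinnertonDyer.Theorems.MazurTateCongruenceAtTwoR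

/-- **K1 `MazurTateCongruenceAtTwoTop` BY NAME from cosocle multiplicity one at the mod-`2` eigen-ideals (`hcosW`) + the period fact at `2` + (DU₂⁻)**
(= `mazurTateCongruenceAtTwoTop_of_sdBz_periodTwo_depletedUnitNegDisc` of `…TopOfManinConstant` with the plus line `plusLineCharTwo_of_sdBz hSD hBz`
replaced by `plusLineCharTwo_of_mcCosocleW exists_maninConstant_ne_zero_holds hcosW` — pointwise through `mazurTateCongruence_of_plusLine`; both curves
of a theta pair have `Δ < 0`; statement otherwise VERBATIM). No Hecke self-duality, no pairing. BSD is not proved by this.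
[cite: GreenbergVatsal2000, Thm. (1.4), §3 (13)] -/
theorem mazurTateCongruenceAtTwoTop_of_cosocleW_periodTwo_depletedUnitNegDisc
    (hcosW : ∀ (W : WeierstrassCurve ℚ) [W.IsElliptic] [W.IsGloballyMinimal], GoodSS W 2 →
      ∀ (L : ℕ) [NeZero L], Odd L →
      (∀ v : HeightOneSpectrum (𝓞 ℚ), ¬ ((primesEquiv v : ℕ) ∣ 2 * L) → W.HasGoodReductionAt v) →
      ∀ (𝔪 : Ideal (HeckeRing0 L 2)), 𝔪.IsMaximal → (2 : HeckeRing0 L 2) ∈ 𝔪 → Nat.card (HeckeRing0 L 2 ⧸ 𝔪) = 2 →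
      (∀ (q : ℕ) (hq : q.Prime), ¬ q ∣ L → HeckeRing0.T L 2 q hq - (W.LFunction q : HeckeRing0 L 2) ∈ 𝔪) →
      Module.finrank (HeckeRing0 L 2 ⧸ 𝔪)
        (periodHomologyHecke L ⧸ (𝔪 • ⊤ : Submodule (HeckeRing0 L 2) (periodHomologyHecke L))) = 2)
    (h2 : realPeriodRat_eq_unit_mul_plusPeriod_two)
    (hDU : ∀ (E : WeierstrassCurve ℚ) [E.IsElliptic] [E.IsGloballyMinimal], GoodSS E 2 → E.frobeniusTrace 2 = 0 → E.Δ < 0 →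
      ∀ [NeZero (E.conductorNorm ℤ)] (f : CuspForm (Gamma0 (E.conductorNorm ℤ)) 2), IsNewformOf E f →
      ∀ (ϖ : ℚ), (ϖ : ℝ) * E.realPeriodRat = plusPeriod f →
      ∀ (S₀ : Finset (HeightOneSpectrum (𝓞 ℚ))), (∀ v ∈ S₀, ((2 : ℕ) : 𝓞 ℚ) ∉ v.asIdeal) →
        (∀ v : HeightOneSpectrum (𝓞 ℚ), ¬ E.HasGoodReductionAt v → v ∈ S₀) →
      ∃ x₀ : ℚ, ‖algebraMap ℚ (PadicAlgCl 2) (2 * ϖ) * (∑ k ∈ Fintype.piFinset (fun _ : S₀ ↦ Finset.range 3), (∏ v : S₀, ((E.localPolynomialAt (v : HeightOneSpectrum (𝓞 ℚ))).map (Int.castRingHom (PadicAlgCl 2))).coeff (k v) * ((Rat.HeightOneSpectrum.natGenerator (v : HeightOneSpectrum (𝓞 ℚ)) : PadicAlgCl 2)⁻¹) ^ (k v)) * algebraMap ℚ (PadicAlgCl 2) (ratPlusSymbol f (x₀ * ((∏ v : S₀, Rat.HeightOneSpectrum.natGenerator (v : HeightOneSpectrum (𝓞 ℚ)) ^ (k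 v) : ℕ) : ℚ))))‖ = 1) :
    Summit.BirchSwinnertonDyer.BirchSwinnertonDyer.Theses.ThetaPartnerAtTwo.MazurTateCongruenceAtTwoTop := by
  intro W _ _ A _ _ _ _ hss ha hAcm hAss hAa he γ _ _ f hf ϖ hϖ Lplus Lminus hPP _ fA hfA ϖA hϖA LplusA LminusA hPPA
    S₀ hS2 hSW hSA G m hG GA m' hGA
  have hΔ : W.Δ < 0 := by
    obtain ⟨e, he'⟩ := he
    exact ThetaPartnerXRoute.Δ_neg_of_cmPartner_two W A hAcm hAss e he'
  have hΔA : A.Δ < 0 := ThetaPartnerXRoute.Δ_neg_of_hasCM_of_goodSS_two A hAcm hAss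
  exact mazurTateCongruence_of_plusLine W A (plusLineAtTwoLevel_of_charTwoLevel (plusLineCharTwo_of_mcCosocleW IsNewformOf.exists_maninConstant_ne_zero_holds hcosW))
    hss hΔ hAss he f hf ϖ hPP fA hfA ϖA hPPA S₀ hS2 hSW hSA
    (symbolMu_of_exists_depletedUnit W h2 hss ha hf hϖ S₀ hS2 (hDU W hss ha hΔ f hf ϖ hϖ S₀ hS2 hSW))
    (symbolMu_of_exists_depletedUnit A h2 hAss hAa hfA hϖA S₀ hS2 (hDU A hAss hAa hΔA fA hfA ϖA hϖA S₀ hS2 hSA)) hG hGA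

/-- **`MazurTateCongruenceAtTwoTop` BY NAME from {cosocle multiplicity one at the mod-`2` eigen-ideals (hcosW)} + the period fact + (DP₂⁻) «depletion preserves primitivity, for `Δ < 0`»**
(`…_of_threeFacts_periodTwo_depletionPrimitiveNegDisc` minus `ES`). BSD is not proved by this. [cite: Ribet1984ICM, Thm. 4.3]
[cite: GreenbergVatsal2000, §3 (13) and Remark 3.4] -/
theorem mazurTateCongruenceAtTwoTop_of_cosocleW_periodTwo_depletionPrimitiveNegDisc
    (hcosW : ∀ (W : WeierstrassCurve ℚ) [W.IsElliptic] [W.IsGloballyMinimal], GoodSS W 2 →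
      ∀ (L : ℕ) [NeZero L], Odd L →
      (∀ v : HeightOneSpectrum (𝓞 ℚ), ¬ ((primesEquiv v : ℕ) ∣ 2 * L) → W.HasGoodReductionAt v) →
      ∀ (𝔪 : Ideal (HeckeRing0 L 2)), 𝔪.IsMaximal → (2 : HeckeRing0 L 2) ∈ 𝔪 → Nat.card (HeckeRing0 L 2 ⧸ 𝔪) = 2 →
      (∀ (q : ℕ) (hq : q.Prime), ¬ q ∣ L → HeckeRing0.T L 2 q hq - (W.LFunction q : HeckeRing0 L 2) ∈ 𝔪) →
      Module.finrank (HeckeRing0 L 2 ⧸ 𝔪)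
        (periodHomologyHecke L ⧸ (𝔪 • ⊤ : Submodule (HeckeRing0 L 2) (periodHomologyHecke L))) = 2)
    (h2 : realPeriodRat_eq_unit_mul_plusPeriod_two)
    (hDP : ∀ (E : WeierstrassCurve ℚ) [E.IsElliptic] [E.IsGloballyMinimal], GoodSS E 2 → E.frobeniusTrace 2 = 0 → E.Δ < 0 →
      ∀ [NeZero (E.conductorNorm ℤ)] (f : CuspForm (Gamma0 (E.conductorNorm ℤ)) 2), IsNewformOf E f →
      ∀ (ϖ : ℚ), (ϖ : ℝ) * E.realPeriodRat = plusPeriod f →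
      ∀ (S₀ : Finset (HeightOneSpectrum (𝓞 ℚ))), (∀ v ∈ S₀, ((2 : ℕ) : 𝓞 ℚ) ∉ v.asIdeal) →
        (∀ v : HeightOneSpectrum (𝓞 ℚ), ¬ E.HasGoodReductionAt v → v ∈ S₀) →
      (∃ r : ℚ, ‖algebraMap ℚ (PadicAlgCl 2) (2 * ϖ) * algebraMap ℚ (PadicAlgCl 2) (ratPlusSymbol f r)‖ = 1) →
      ∃ x₀ : ℚ, ‖algebraMap ℚ (PadicAlgCl 2) (2 * ϖ) * (∑ k ∈ Fintype.piFinset (fun _ : S₀ ↦ Finset.range 3), (∏ v : S₀, ((E.localPolynomialAt (v : HeightOneSpectrum (𝓞 ℚ))).map (Int.castRingHom (PadicAlgCl 2))).coeff (k v) * ((Rat.HeightOneSpectrum.natGenerator (v : HeightOneSpectrum (𝓞 ℚ)) : PadicAlgCl 2)⁻¹) ^ (k v)) * algebraMap ℚ (PadicAlgCl 2) (ratPlusSymbol f (x₀ * ((∏ v : S₀, Rat.HeightOneSpectrum.natGenerator (v : HeightOneSpectrum (𝓞 ℚ)) ^ (k v) : ℕ) : ℚ))))‖ = 1) :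
    Summit.BirchSwinnertonDyer.BirchSwinnertonDyer.Theses.ThetaPartnerAtTwo.MazurTateCongruenceAtTwoTop := by
  refine mazurTateCongruenceAtTwoTop_of_cosocleW_periodTwo_depletedUnitNegDisc hcosW h2 ?_
  intro E _ _ hss ha hΔ _ f hf ϖ hϖ S₀ hS2 hSE
  exact hDP E hss ha hΔ f hf ϖ hϖ S₀ hS2 hSE (exists_undepletedUnit E h2 hss hf hϖ)

/-- **`MazurTateCongruenceAtTwoTop` BY NAME from {cosocle multiplicity one at the mod-`2` eigen-ideals (hcosW)} + the period fact + (IH₂⁻) «Ihara's lemma mod `2` in symbol form»**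
(`…_of_threeFacts_periodTwo_ihara` minus `ES`). BSD is not proved by this. [cite: Ribet1984ICM, Thm. 4.1 and Thm. 4.3]
[cite: GreenbergVatsal2000, §3 (13)] -/
theorem mazurTateCongruenceAtTwoTop_of_cosocleW_periodTwo_ihara
    (hcosW : ∀ (W : WeierstrassCurve ℚ) [W.IsElliptic] [W.IsGloballyMinimal], GoodSS W 2 →
      ∀ (L : ℕ) [NeZero L], Odd L →
      (∀ v : HeightOneSpectrum (𝓞 ℚ), ¬ ((primesEquiv v : ℕ) ∣ 2 * L) → W.HasGoodReductionAt v) →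
      ∀ (𝔪 : Ideal (HeckeRing0 L 2)), 𝔪.IsMaximal → (2 : HeckeRing0 L 2) ∈ 𝔪 → Nat.card (HeckeRing0 L 2 ⧸ 𝔪) = 2 →
      (∀ (q : ℕ) (hq : q.Prime), ¬ q ∣ L → HeckeRing0.T L 2 q hq - (W.LFunction q : HeckeRing0 L 2) ∈ 𝔪) →
      Module.finrank (HeckeRing0 L 2 ⧸ 𝔪)
        (periodHomologyHecke L ⧸ (𝔪 • ⊤ : Submodule (HeckeRing0 L 2) (periodHomologyHecke L))) = 2)
    (h2 : realPeriodRat_eq_unit_mul_plusPeriod_two)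
    (hIH : ∀ (W : WeierstrassCurve ℚ) [W.IsElliptic] [W.IsGloballyMinimal], GoodSS W 2 → W.Δ < 0 → ∀ (N' : ℕ), Odd N' →
      (∀ v : IsDedekindDomain.HeightOneSpectrum (NumberField.RingOfIntegers ℚ), ¬ ((Rat.HeightOneSpectrum.primesEquiv v : ℕ) ∣ 2 * N') → W.HasGoodReductionAt v) →
      ∀ (ℓ : ℕ), ℓ.Prime → ℓ ≠ 2 → ∀ (Φ : ℚ → PadicAlgCl 2),
      (∀ (r : ℚ) (z : ℤ), Φ (r + z) = Φ r) → (∀ r : ℚ, Φ (-r) = Φ r) → (∀ (γ : CongruenceSubgroup.Gamma0 (N')) (r : ℚ), ((γ : SL(2, ℤ)) 1 0 : ℚ) * r + ((γ : SL(2, ℤ)) 1 1 : ℚ) ≠ 0 → Φ ((((γ : SL(2, ℤ)) 0 0 : ℚ) * r + ((γ : SL(2, ℤ)) 0 1 : ℚ)) / (((γ : SL(2, ℤ)) 1 0 : ℚ) * r + ((γ : SL(2, ℤ)) 1 1 : ℚ))) = (if ((γ : SL(2, ℤ)) 1 0) = 0 then 0 else Φ ((((γ : SL(2, ℤ)) 0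 0 : ℚ)) / (((γ : SL(2, ℤ)) 1 0 : ℚ)))) + Φ r) →
      (∀ r : ℚ, ‖Φ r‖ ≤ 1) →
      (∀ q : ℕ, q.Prime → ¬ q ∣ 2 * N' * ℓ → ∀ r : ℚ, ‖(∑ j : Fin q, Φ ((r + j) / q)) + Φ (q * r) - (W.LFunction q : PadicAlgCl 2) * Φ r‖ < 1) →
      (∀ (r : ℚ) (j : ℤ) (n : ℕ), ‖Φ (r + j / (ℓ : ℚ) ^ n) - Φ r‖ < 1) →
      ∀ r : ℚ, ‖Φ r‖ < 1) :
    Summit.BirchSwinnertonDyer.BirchSwinnertonDyer.Theses.ThetaPartnerAtTwo.MazurTateCongruenceAtTwoTop :=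
  mazurTateCongruenceAtTwoTop_of_cosocleW_periodTwo_depletionPrimitiveNegDisc hcosW h2 (stub_depletionPrimitiveNegDisc_of_ihara h2 hIH)

/-- **K1 BY NAME FROM cosocle multiplicity one (`hcosW`) + THE PERIOD FACT AT `2`, nothing else** — (IH₂⁻) is the landed theorem
`stub_iharaSymbolModTwoNegDisc`, (DP₂⁻) the landed `stub_depletionPrimitiveNegDisc_of_ihara`, the plus line is `plusLineCharTwo_of_mcCosocleW` (ES-free,
Serre-free, SD-free). `hcosW` is supplied by ONE fact of Buzzard's printed shape read on the Picard carrier (`cosocleAtEigenIdeal_of_cosocleFact`), or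
today by {`buzzard2000_multiplicityOne_gamma0`, the intersection pairing}. BSD is not proved by this. [cite: GreenbergVatsal2000, Thm. (1.4) and §3 (13)]
[cite: Ribet1984ICM, Thm. 4.3] [cite: DokchitserDokchitserMathZ2012, Theorem (1)] [cite: Knapp1993, Thm. 11.74 (d)] -/
theorem mazurTateCongruenceAtTwoTop_of_cosocleW_periodTwo
    (hcosW : ∀ (W : WeierstrassCurve ℚ) [W.IsElliptic] [W.IsGloballyMinimal], GoodSS W 2 →
      ∀ (L : ℕ) [NeZero L], Odd L →
      (∀ v : HeightOneSpectrum (𝓞 ℚ), ¬ ((primesEquiv v : ℕ) ∣ 2 * L) → W.HasGoodReductionAt v) →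
      ∀ (𝔪 : Ideal (HeckeRing0 L 2)), 𝔪.IsMaximal → (2 : HeckeRing0 L 2) ∈ 𝔪 → Nat.card (HeckeRing0 L 2 ⧸ 𝔪) = 2 →
      (∀ (q : ℕ) (hq : q.Prime), ¬ q ∣ L → HeckeRing0.T L 2 q hq - (W.LFunction q : HeckeRing0 L 2) ∈ 𝔪) →
      Module.finrank (HeckeRing0 L 2 ⧸ 𝔪)
        (periodHomologyHecke L ⧸ (𝔪 • ⊤ : Submodule (HeckeRing0 L 2) (periodHomologyHecke L))) = 2)
    (h2 : realPeriodRat_eq_unit_mul_plusPeriod_two) :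
    Summit.BirchSwinnertonDyer.BirchSwinnertonDyer.Theses.ThetaPartnerAtTwo.MazurTateCongruenceAtTwoTop :=
  mazurTateCongruenceAtTwoTop_of_cosocleW_periodTwo_ihara hcosW h2 stub_iharaSymbolModTwoNegDisc

/-- The twin `MazurTateCongruenceAtTwoR` (item 21416) BY NAME from {cosocle multiplicity one at the mod-`2` eigen-ideals (hcosW)} + the period fact. [cite: GreenbergVatsal2000, §3 (13)] -/
theorem mazurTateCongruenceAtTwoR_of_cosocleW_periodTwo
    (hcosW : ∀ (W : WeierstrassCurve ℚ) [W.IsElliptic] [W.IsGloballyMinimal], GoodSS W 2 →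
      ∀ (L : ℕ) [NeZero L], Odd L →
      (∀ v : HeightOneSpectrum (𝓞 ℚ), ¬ ((primesEquiv v : ℕ) ∣ 2 * L) → W.HasGoodReductionAt v) →
      ∀ (𝔪 : Ideal (HeckeRing0 L 2)), 𝔪.IsMaximal → (2 : HeckeRing0 L 2) ∈ 𝔪 → Nat.card (HeckeRing0 L 2 ⧸ 𝔪) = 2 →
      (∀ (q : ℕ) (hq : q.Prime), ¬ q ∣ L → HeckeRing0.T L 2 q hq - (W.LFunction q : HeckeRing0 L 2) ∈ 𝔪) →
      Module.finrank (HeckeRing0 L 2 ⧸ 𝔪)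
        (periodHomologyHecke L ⧸ (𝔪 • ⊤ : Submodule (HeckeRing0 L 2) (periodHomologyHecke L))) = 2)
    (h2 : realPeriodRat_eq_unit_mul_plusPeriod_two) :
    Summit.BirchSwinnertonDyer.BirchSwinnertonDyer.Theses.ThetaPartnerAtTwo.MazurTateCongruenceAtTwoR :=
  mazurTateCongruenceAtTwoTop_of_cosocleW_periodTwo hcosW h2

/-- **Greenberg–Vatsal `μ`-invariance at `2` on the theta habitat from {cosocle multiplicity one at the mod-`2` eigen-ideals (hcosW)} + the period fact** (w4 g0's
`muInvarianceAtTwo_of_threeFacts_periodTwo` with `ES` dropped): for every theta pair, newforms and Pollack pairs at `2`, `L♭_W` has a unit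
coefficient iff `L♭_A` does. BSD is not proved by this. [cite: GreenbergVatsal2000, Thm. (1.4) and §3 (13)] [cite: Vatsal1999, Thm. (1.10)] -/
theorem muInvarianceAtTwo_of_cosocleW_periodTwo
    (hcosW : ∀ (W : WeierstrassCurve ℚ) [W.IsElliptic] [W.IsGloballyMinimal], GoodSS W 2 →
      ∀ (L : ℕ) [NeZero L], Odd L →
      (∀ v : HeightOneSpectrum (𝓞 ℚ), ¬ ((primesEquiv v : ℕ) ∣ 2 * L) → W.HasGoodReductionAt v) →
      ∀ (𝔪 : Ideal (HeckeRing0 L 2)), 𝔪.IsMaximal → (2 : HeckeRing0 L 2) ∈ 𝔪 → Nat.card (HeckeRing0 L 2 ⧸ 𝔪) = 2 →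
      (∀ (q : ℕ) (hq : q.Prime), ¬ q ∣ L → HeckeRing0.T L 2 q hq - (W.LFunction q : HeckeRing0 L 2) ∈ 𝔪) →
      Module.finrank (HeckeRing0 L 2 ⧸ 𝔪)
        (periodHomologyHecke L ⧸ (𝔪 • ⊤ : Submodule (HeckeRing0 L 2) (periodHomologyHecke L))) = 2)
    (h2 : realPeriodRat_eq_unit_mul_plusPeriod_two) :
    ∀ (W : WeierstrassCurve ℚ) [W.IsElliptic] [W.IsGloballyMinimal] (A : WeierstrassCurve ℚ) [A.IsElliptic]
      [A.IsGloballyMinimal], ¬ W.HasCM → W.analyticRank = 0 → GoodSS W 2 → W.frobeniusTrace 2 = 0 → A.HasCM → GoodSS A 2 →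
      A.frobeniusTrace 2 = 0 →
      (∃ e : geomTorsion W (2 : ℤ) ≃+ geomTorsion A (2 : ℤ),
        ∀ (σ : Field.absoluteGaloisGroup ℚ) (P : geomTorsion W (2 : ℤ)), e (σ • P) = σ • e P) →
      ∀ [NeZero (W.conductorNorm ℤ)] (f : CuspForm (Gamma0 (W.conductorNorm ℤ)) 2), IsNewformOf W f →
      ∀ (Lplus Lminus : IwasawaAlgebra 2), IsPollackPair f 2 Lplus Lminus →
      ∀ [NeZero (A.conductorNorm ℤ)] (fA : CuspForm (Gamma0 (A.conductorNorm ℤ)) 2), IsNewformOf A fA →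
      ∀ (LplusA LminusA : IwasawaAlgebra 2), IsPollackPair fA 2 LplusA LminusA →
      ((∃ n : ℕ, IsUnit (PowerSeries.coeff n (kobayashiL 1 Lplus Lminus))) ↔
        (∃ n : ℕ, IsUnit (PowerSeries.coeff n (kobayashiL 1 LplusA LminusA)))) :=
  flatIff_of_mazurTateCongruenceAtTwoTop h2 (mazurTateCongruenceAtTwoTop_of_cosocleW_periodTwo hcosW h2)

/-- **K1 `MazurTateCongruenceAtTwoTop` BY NAME from ONE fact of Buzzard's printed shape READ ON THE PICARD CARRIER + the period fact at `2`**
(`hBzPic` spelled inline = the hypothesis of `thetaLayerLambdaCongruenceAtTwo_of_cosocleFact`; its curve-level consequence `hcosW` by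
`cosocleAtEigenIdeal_of_cosocleFact`). Trust base {Buzzard 2000 Prop. 2.4 (Picard reading), `realPeriodRat_eq_unit_mul_plusPeriod_two`}; the Hecke
self-duality of `J₀(N)[2]` is NOT used. Conditional; BSD is not proved by this. [cite: Buzzard2000LevelLoweringModTwo, Prop. 2.4 and Def. 2.1–2.2 (p. 100–101)]
[cite: GreenbergVatsal2000, Thm. (1.4) and §3 (13)] -/
theorem mazurTateCongruenceAtTwoTop_of_cosocleFact_periodTwo
    (hBzPic : ∀ (N : ℕ) [NeZero N], Odd N →
      ∀ (𝔪 : Ideal (HeckeRing0 N 2)), 𝔪.IsMaximal → (2 : HeckeRing0 N 2) ∈ 𝔪 →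
      ∀ (k : Type) [Field k] [IsAlgClosed k] [TopologicalSpace k] [DiscreteTopology k]
        (ι : HeckeRing0 N 2 ⧸ 𝔪 →+* k) (ρ : ModPGaloisRep ℚ k 2),
        (∀ v : HeightOneSpectrum (𝓞 ℚ), ¬ ((primesEquiv v : Nat.Primes) : ℕ) ∣ 2 * N →
          ρ.IsUnramifiedAt v ∧
            ρ.HasFrobCharpolyAt v
              (X ^ 2
                - C (ι (Ideal.Quotient.mk 𝔪 (HeckeRing0.T N 2
                    ((primesEquiv v : Nat.Primes) : ℕ) (primesEquiv v : Nat.Primes).2))) * X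
                + C (((primesEquiv v : Nat.Primes) : ℕ) : k))) →
        FramedRep.IsIrreducible ρ →
        (∀ v : HeightOneSpectrum (𝓞 ℚ), ((primesEquiv v : Nat.Primes) : ℕ) = 2 →
          ∀ 𝔓 ∈ v.primesAbove, ∃ σ ∈ 𝔓.decompositionSubgroup (Field.absoluteGaloisGroup ℚ),
            ∀ c : k, ((ρ σ : GL (Fin 2) k) : Matrix (Fin 2) (Fin 2) k) ≠ Matrix.scalar (Fin 2) c) →
        Module.finrank (HeckeRing0 N 2 ⧸ 𝔪)
          (periodHomologyHecke N ⧸ (𝔪 • ⊤ : Submodule (HeckeRing0 N 2) (periodHomologyHecke N))) = 2)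
    (h2 : realPeriodRat_eq_unit_mul_plusPeriod_two) :
    Summit.BirchSwinnertonDyer.BirchSwinnertonDyer.Theses.ThetaPartnerAtTwo.MazurTateCongruenceAtTwoTop :=
  mazurTateCongruenceAtTwoTop_of_cosocleW_periodTwo (cosocleAtEigenIdeal_of_cosocleFact hBzPic) h2

end Summit.BirchSwinnertonDyer.BirchSwinnertonDyer.Theorems.MazurTateCongruenceAtTwoR

end
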